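import Summits.QuantumFields.GaugeBoot.TiltedLatticeAxisRPNegative
import Summits.QuantumFields.GaugeBoot.TiltedLatticeMidReflection
import Summits.QuantumFields.GaugeBoot.TiltedBoxOddAxisGaugeGroups
import HarnessLib

/-!
# In-plane LINK reflection positivity FAILS on the square tilted box of ODD side, every real `β` (gauge-boot, L3 negative supplement)

HONEST FRAMING (cell `pub-gaugeboot`, page 1 of every file): the venture produces certified bounds
on lattice expectations at stated coupling, gauge group, dimension and torus size; NOT a mass gap,
NOT a continuum limit, NOT a string tension; NOT Yang–Mills-summit-bearing (barriers
`FixedCouplingUltralocality`, `PerturbativeInvisibility`). This module is a small NEGATIVE result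
about which positivity blocks a certificate on the tilted box may use; it discharges nothing else.

The last of the four conjugacy classes of in-plane mirrors `x_i ↦ c - x_i` of the square tilted box
`ℤ^d/Γ(M, M, L)` (`c` is defined modulo `2M`, translations shift it by even amounts, and for even
`M` also by `M`): ODD side `M = 2P + 1`, LINK mirror `x_i ↦ 1 - x_i`
(`Θ = configMidReflect e i Θ_i`, `TiltedLinkRPGeometry.lean` / `TiltedLatticeMidReflection.lean`).
Its two fixed loci are the slab at `½` (reflected EXACTLY) and the LAYER `x_i ≡ P + 1`, which is
mapped to itself TWISTED by the half period `T = [M e_j] ≠ 0`: **`midReflect_of_axisCoord_eq_succ`**,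
`θ y = y + T` there (from the twist lemma `Θ_i y = y + e_i + T` of the layer `P`,
`TiltedBoxOddAxisGeometry.lean`). A twisted layer inside the closed half `{1 ≤ x_i ≤ P + 1}` kills
reflection positivity at EVERY real `β` by the two-link odd observable of
`TiltedLatticeAxisRPNegative.lean` — here in its mid-plane form:

* **`IsAxisFlip.exists_integral_conj_mul_neg_mid`** — for ANY axis flip `σ` along `k` on any
  periodic lattice and a link `(x, m)`, `m ≠ k`, whose base point is MOVED by `θ = midReflect`
  (`θ x ≠ x`): `F(U) = g(U(x, m)) - g(U(θx, m))` is odd under `Θ_mid`, so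
  `∫ conj F(Θ_mid U) · F(U) dμ_β = -∫ F² dμ_β < 0` (non-trivial compact Hausdorff second countable
  `G`, continuous `ρ`, every real `β`);
* **`tiltedBox_midAxisRP_neg_odd`** / **`not_tiltedBox_midAxisRP_odd`** — on `ℤ^d/Γ(2P+1, 2P+1, L)`
  (`P, L ≥ 1`, `i ≠ j`, ANY `d ≥ 2`) closed-half link RP along `i` (observables of the links with
  both endpoints in `{1 ≤ x_i ≤ P + 1 (mod 2P+1)}`, stated through `axisCoord`; the tree's
  `InMidHalf` needs an even modulus) FAILS at every real `β`; `_suN` (`N ≥ 2`), `_uN` (`N ≥ 1`).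

With `not_tiltedBox_axisRP` (even side, site mirror, every real `β`), `not_tiltedBox_axisRP_odd`
(odd side, site mirror, `β > 0`, `d ≥ 3`) and `not_tiltedBox_midAxisRP` (even side, link mirror,
`β > 0`, `d ≥ 3`) the classification of the in-plane mirrors of square tilted boxes by positivity
is complete in `d ≥ 3`: none is of positive type (all are symmetries of `μ_β`). `[folklore]`
mechanism; small new negative.

References: J. Fröhlich, R. Israel, E. H. Lieb, B. Simon, J. Stat. Phys. 22 (1980) 297, §3;
K. Osterwalder, E. Seiler, Ann. Phys. 110 (1978) 440, §2; V. Kazakov, Z. Zheng,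
arXiv:2203.11360 §3.1 (link reflections).
-/

noncomputable section

open MeasureTheory Complex QuotientAddGroup
open scoped ComplexOrder ComplexConjugate
open Literature.MathematicalPhysics.QuantumFieldTheory (haarProbability)
open Literature.RepresentationTheory.CompactGroups
open Literature.MathematicalPhysics.QuantumLattice

namespace Summit.QuantumFields.GaugeBoot

namespace TiltedRP

/-! ## The abstract two-link negative for a mid-plane reflection -/

section Abstract

variable {A : Type*} [AddCommGroup A] [Fintype A] {d N : ℕ} {G : Type*} [Group G]
  [TopologicalSpace G] [IsTopologicalGroup G] [CompactSpace G] [MeasurableSpace G] [BorelSpace G]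
  [SecondCountableTopology G]
variable (ρ : G →* Matrix (Fin N) (Fin N) ℂ)

/-- **Link RP fails as soon as the mid-plane reflection moves a layer link** (any periodic lattice,
every coupling). Let `σ` be an axis flip along `k`, `θ = midReflect e k σ`,
`Θ = configMidReflect e k σ`, and `(x, m)` a link with `m ≠ k` whose base point is NOT fixed by `θ`,
`θ x ≠ x`. For non-trivial compact Hausdorff second countable `G`, continuous `ρ` and EVERY real `β`
there is a measurable `F`, `‖F‖ ≤ 1`, depending only on the two link variables `U(x, m)`,
`U(θx, m)`, odd under `Θ`, with `∫ conj F(ΘU) · F(U) dμ_β < 0`. Witness: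
`F(U) = g(U(x, m)) - g(U(θx, m))`, `g : G → [0, 1]` continuous separating two points. [folklore] -/
theorem IsAxisFlip.exists_integral_conj_mul_neg_mid [Nontrivial G] [T2Space G] {e : Fin d → A}
    {k : Fin d} {σ : A →+ A} (hF : IsAxisFlip e k σ) (hρ : Continuous ρ) (β : ℝ) {x : A}
    {m : Fin d} (hm : m ≠ k) (hx : midReflect e k σ x ≠ x) :
    ∃ F : Config A d G → ℂ, Measurable F ∧ (∀ U, ‖F U‖ ≤ 1) ∧
      (∀ U V : Config A d G, U (x, m) = V (x, m) →
        U (midReflect e k σ x, m) = V (midReflect e k σ x, m) → F U = F V) ∧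
      (∀ U, F (configMidReflect e k σ U) = -F U) ∧
      ∫ U, conj (F (configMidReflect e k σ U)) * F U ∂(gibbs ρ e β) < 0 := by
  classical
  obtain ⟨a, b, hab⟩ := exists_pair_ne G
  obtain ⟨g, hga, hgb, hg01⟩ := exists_continuous_zero_one_of_isClosed
    (isClosed_singleton (x := a)) (isClosed_singleton (x := b)) (Set.disjoint_singleton.2 hab)
  have hne : ((x, m) : Link A d) ≠ (midReflect e k σ x, m) := fun h' => hx (Prod.ext_iff.1 h').1.symm
  set h : Config A d G → ℝ := fun U => g (U (x, m)) - g (U (midReflect e k σ x, m)) with hh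
  have hh_meas : Measurable h :=
    (g.continuous.measurable.comp (measurable_pi_apply _)).sub
      (g.continuous.measurable.comp (measurable_pi_apply _))
  have hh_bound : ∀ U, |h U| ≤ 1 := fun U => by
    rw [hh, abs_sub_le_iff]
    constructor <;> linarith [(hg01 (U (x, m))).1, (hg01 (U (x, m))).2, (hg01 (U (midReflect e k σ x, m))).1,
      (hg01 (U (midReflect e k σ x, m))).2]
  have hh_odd : ∀ U, h (configMidReflect e k σ U) = -h U := fun U => by
    simp only [hh, configMidReflect_other e k σ U _ hm, hF.midReflect_midReflect]
    ring
  refine ⟨fun U => (h U : ℂ), Complex.measurable_ofReal.comp hh_meas, fun U => ?_,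
    fun U V h1 h2 => ?_, fun U => ?_, ?_⟩
  · rw [Complex.norm_real, Real.norm_eq_abs]
    exact hh_bound U
  · simp only [hh, h1, h2]
  · show ((h (configMidReflect e k σ U) : ℝ) : ℂ) = -((h U : ℝ) : ℂ)
    rw [hh_odd]
    push_cast
    ring
  · have hint : (fun U => conj ((h (configMidReflect e k σ U) : ℝ) : ℂ) * (h U : ℂ)) =
        fun U => ((-(h U ^ 2) : ℝ) : ℂ) := by
      funext U
      rw [Complex.conj_ofReal, hh_odd]
      push_cast
      ring
    rw [hint, integral_complex_ofReal, ← Complex.ofReal_zero, Complex.real_lt_real, integral_neg,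
      neg_lt_zero]
    set O : Set (Config A d G) :=
      (fun U : Config A d G => U (x, m)) ⁻¹' (g ⁻¹' Set.Iio (1 / 2 : ℝ)) ∩
        (fun U : Config A d G => U (midReflect e k σ x, m)) ⁻¹' (g ⁻¹' Set.Ioi (1 / 2 : ℝ)) with hOdef
    have hO : IsOpen O :=
      ((isOpen_Iio.preimage g.continuous).preimage (continuous_apply _)).inter
        ((isOpen_Ioi.preimage g.continuous).preimage (continuous_apply _))
    have hOne : O.Nonempty := by
      refine ⟨Function.update (fun _ => a) (midReflect e k σ x, m) b, ?_, ?_⟩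
      · simp only [Set.mem_preimage, Function.update_of_ne hne, hga rfl, Set.mem_Iio]; norm_num
      · simp only [Set.mem_preimage, Function.update_self, hgb rfl, Set.mem_Ioi]; norm_num
    have hOh : ∀ U ∈ O, h U ≠ 0 := by
      rintro U ⟨h1, h2⟩
      simp only [Set.mem_preimage, Set.mem_Iio, Set.mem_Ioi] at h1 h2
      show g (U (x, m)) - g (U (midReflect e k σ x, m)) ≠ 0
      exact (by linarith : g (U (x, m)) - g (U (midReflect e k σ x, m)) < 0).ne
    exact integral_sq_gibbs_pos ρ hρ e β hh_meas hh_bound hO hOne hOh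

end Abstract

/-! ## The odd square box: the twisted layer `x_i ≡ P + 1` of the link mirror -/

section Box

variable (d : ℕ) {i j : Fin d} (L P : ℕ)

/-- **The twisted layer of the link mirror on the odd box**: for `y` in the layer `x_i ≡ P` of
`ℤ^d/Γ(2P+1, 2P+1, L)`, the site `y + e_i` of the layer `P + 1` is carried by
`θ = midReflect e i Θ_i` to `θ (y + e_i) = Θ_i y = (y + e_i) + T` — the layer `P + 1` is mapped onto
itself, translated by the half period `T = [(2P+1) e_j]`. [folklore] -/
theorem midReflect_of_axisCoord_eq_succ (hij : i ≠ j) (y : TiltedSite d i j (2 * P + 1) (2 * P + 1) L)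
    (hy : axisCoord d L (2 * P + 1) y = ((P : ℕ) : ZMod (2 * P + 1))) :
    midReflect (tiltedUnit d i j (2 * P + 1) (2 * P + 1) L) i (tiltedAxisFlip d L (2 * P + 1) hij)
        (y + tiltedUnit d i j (2 * P + 1) (2 * P + 1) L i) =
      y + tiltedUnit d i j (2 * P + 1) (2 * P + 1) L i + tiltedTwist d L (2 * P + 1) := by
  rw [(isAxisFlip_tiltedAxisFlip d L (2 * P + 1) hij).midReflect_add_self,
    tiltedAxisFlip_of_axisCoord_eq d L P hij y hy]

end Box

/-! ## The negative on the odd box -/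

section Main

variable {d : ℕ} {i j : Fin d} {L P N : ℕ} [NeZero L] [NeZero P]
variable {G : Type*} [Group G] [TopologicalSpace G] [IsTopologicalGroup G] [CompactSpace G]
  [MeasurableSpace G] [BorelSpace G] [SecondCountableTopology G]
variable (ρ : G →* Matrix (Fin N) (Fin N) ℂ)

omit [NeZero P] in
/-- **In-plane LINK reflection positivity FAILS on the square tilted box of odd side, at every
coupling.** Box `ℤ^d/Γ(2P+1, 2P+1, L)` (`P ≥ 1`, `L ≥ 1`, `i ≠ j`), `Θ = configMidReflect … i Θ_i`
(`x_i ↦ 1 - x_i`); `G` non-trivial compact Hausdorff second countable, `ρ` continuous, `β ∈ ℝ`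
arbitrary. There is a measurable `F`, `‖F‖ ≤ 1`, depending only on the two `j`-links based at
`y₁ = [P e_i] + e_i` and `y₁ + T` (both with both endpoints in the layer `x_i ≡ P + 1`, inside the
closed half `{1 ≤ x_i ≤ P + 1}` of the link mirror), odd under `Θ`, with
`∫ conj F(ΘU) · F(U) dμ_β < 0`. [folklore] -/
theorem tiltedBox_midAxisRP_neg_odd [Nontrivial G] [T2Space G] (hij : i ≠ j) (hρ : Continuous ρ) (β : ℝ) :
    ∃ F : Config (TiltedSite d i j (2 * P + 1) (2 * P + 1) L) d G → ℂ, Measurable F ∧ (∀ U, ‖F U‖ ≤ 1) ∧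
      (∀ U V : Config (TiltedSite d i j (2 * P + 1) (2 * P + 1) L) d G,
        U (oddLayerSite d i j L P + tiltedUnit d i j (2 * P + 1) (2 * P + 1) L i, j) =
          V (oddLayerSite d i j L P + tiltedUnit d i j (2 * P + 1) (2 * P + 1) L i, j) →
        U (oddLayerSite d i j L P + tiltedUnit d i j (2 * P + 1) (2 * P + 1) L i + tiltedTwist d L (2 * P + 1), j) =
          V (oddLayerSite d i j L P + tiltedUnit d i j (2 * P + 1) (2 * P + 1) L i + tiltedTwist d L (2 * P + 1), j) →
        F U = F V) ∧
      (∀ U, F (configMidReflect (tiltedUnit d i j (2 * P + 1) (2 * P + 1) L) i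
        (tiltedAxisFlip d L (2 * P + 1) hij) U) = -F U) ∧
      ∫ U, conj (F (configMidReflect (tiltedUnit d i j (2 * P + 1) (2 * P + 1) L) i
          (tiltedAxisFlip d L (2 * P + 1) hij) U)) * F U
        ∂(gibbs ρ (tiltedUnit d i j (2 * P + 1) (2 * P + 1) L) β) < 0 := by
  have hθ := midReflect_of_axisCoord_eq_succ d L P hij (oddLayerSite d i j L P) axisCoord_oddLayerSite
  have hx : midReflect (tiltedUnit d i j (2 * P + 1) (2 * P + 1) L) i (tiltedAxisFlip d L (2 * P + 1) hij)
      (oddLayerSite d i j L P + tiltedUnit d i j (2 * P + 1) (2 * P + 1) L i) ≠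
      oddLayerSite d i j L P + tiltedUnit d i j (2 * P + 1) (2 * P + 1) L i := by
    rw [hθ]
    intro h
    exact tiltedTwist_ne_zero (L := L) (P := P) hij (by simpa using h)
  obtain ⟨F, hFm, hFb, hFdep, hFodd, hneg⟩ :=
    (isAxisFlip_tiltedAxisFlip d L (2 * P + 1) hij).exists_integral_conj_mul_neg_mid ρ hρ β hij.symm hx
  refine ⟨F, hFm, hFb, fun U V h1 h2 => hFdep U V h1 ?_, hFodd, hneg⟩
  rw [hθ]
  exact h2

/-- **Corollary: closed-half LINK reflection positivity is FALSE along the axis `i` of the square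
tilted box of odd side `2P + 1`** (`P, L ≥ 1`, `i ≠ j`, any `d ≥ 2`, every real `β`, every
non-trivial compact Hausdorff second countable `G`, continuous `ρ`): with the closed half
`{1 ≤ x_i ≤ P + 1 (mod 2P+1)}` of the link mirror `x_i ↦ 1 - x_i` (read through `axisCoord`;
observables of the links with both endpoints in it) there is no positivity. -/
theorem not_tiltedBox_midAxisRP_odd [Nontrivial G] [T2Space G] (hij : i ≠ j) (hρ : Continuous ρ) (β : ℝ) :
    ¬ ∀ F : Config (TiltedSite d i j (2 * P + 1) (2 * P + 1) L) d G → ℂ, Measurable F →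
        (∃ C : ℝ, ∀ U, ‖F U‖ ≤ C) →
        (∀ U V : Config (TiltedSite d i j (2 * P + 1) (2 * P + 1) L) d G,
          (∀ l : Link (TiltedSite d i j (2 * P + 1) (2 * P + 1) L) d,
            (1 ≤ (axisCoord d L (2 * P + 1) l.1).val ∧ (axisCoord d L (2 * P + 1) l.1).val ≤ P + 1) →
            (1 ≤ (axisCoord d L (2 * P + 1) (l.1 + tiltedUnit d i j (2 * P + 1) (2 * P + 1) L l.2)).val ∧
              (axisCoord d L (2 * P + 1) (l.1 + tiltedUnit d i j (2 * P + 1) (2 * P + 1) L l.2)).val ≤ P + 1) →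
            U l = V l) → F U = F V) →
        0 ≤ ∫ U, conj (F (configMidReflect (tiltedUnit d i j (2 * P + 1) (2 * P + 1) L) i
          (tiltedAxisFlip d L (2 * P + 1) hij) U)) * F U
          ∂(gibbs ρ (tiltedUnit d i j (2 * P + 1) (2 * P + 1) L) β) := by
  intro hRP
  obtain ⟨F, hFm, hFb, hFdep, -, hneg⟩ := tiltedBox_midAxisRP_neg_odd (L := L) (P := P) ρ hij hρ β
  -- the two links lie in the layer `x_i ≡ P + 1`
  have hval : (((P : ℕ) : ZMod (2 * P + 1)) + 1).val = P + 1 := by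
    have h : ((P : ℕ) : ZMod (2 * P + 1)) + 1 = ((P + 1 : ℕ) : ZMod (2 * P + 1)) := by push_cast; ring
    rw [h, ZMod.val_natCast]
    exact Nat.mod_eq_of_lt (by have := NeZero.ne P; omega)
  have hlay : ∀ v : TiltedSite d i j (2 * P + 1) (2 * P + 1) L, axisCoord d L (2 * P + 1) v = 0 →
      (axisCoord d L (2 * P + 1) (oddLayerSite d i j L P + tiltedUnit d i j (2 * P + 1) (2 * P + 1) L i + v)).val
        = P + 1 := fun v hv => by
    rw [map_add, axisCoord_add_tiltedUnit, if_pos rfl, axisCoord_oddLayerSite, hv, add_zero, hval]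
  have hlink : ∀ v : TiltedSite d i j (2 * P + 1) (2 * P + 1) L, axisCoord d L (2 * P + 1) v = 0 →
      ∀ U V : Config (TiltedSite d i j (2 * P + 1) (2 * P + 1) L) d G,
      (∀ l : Link (TiltedSite d i j (2 * P + 1) (2 * P + 1) L) d,
          (1 ≤ (axisCoord d L (2 * P + 1) l.1).val ∧ (axisCoord d L (2 * P + 1) l.1).val ≤ P + 1) →
          (1 ≤ (axisCoord d L (2 * P + 1) (l.1 + tiltedUnit d i j (2 * P + 1) (2 * P + 1) L l.2)).val ∧
            (axisCoord d L (2 * P + 1) (l.1 + tiltedUnit d i j (2 * P + 1) (2 * P + 1) L l.2)).val ≤ P + 1) →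
          U l = V l) →
      U (oddLayerSite d i j L P + tiltedUnit d i j (2 * P + 1) (2 * P + 1) L i + v, j) =
        V (oddLayerSite d i j L P + tiltedUnit d i j (2 * P + 1) (2 * P + 1) L i + v, j) := by
    intro v hv U V hUV
    refine hUV _ ⟨?_, ?_⟩ ⟨?_, ?_⟩
    · rw [hlay v hv]; omega
    · rw [hlay v hv]
    · show 1 ≤ (axisCoord d L (2 * P + 1) (oddLayerSite d i j L P + tiltedUnit d i j (2 * P + 1) (2 * P + 1) L i +
        v + tiltedUnit d i j (2 * P + 1) (2 * P + 1) L j)).val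
      rw [add_assoc _ v, hlay _ (by rw [map_add, hv, axisCoord_tiltedUnit_of_ne d L _ hij.symm, add_zero])]
      omega
    · show (axisCoord d L (2 * P + 1) (oddLayerSite d i j L P + tiltedUnit d i j (2 * P + 1) (2 * P + 1) L i +
        v + tiltedUnit d i j (2 * P + 1) (2 * P + 1) L j)).val ≤ P + 1
      rw [add_assoc _ v, hlay _ (by rw [map_add, hv, axisCoord_tiltedUnit_of_ne d L _ hij.symm, add_zero])]
  have hFo : ∀ U V : Config (TiltedSite d i j (2 * P + 1) (2 * P + 1) L) d G,
      (∀ l : Link (TiltedSite d i j (2 * P + 1) (2 * P + 1) L) d,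
          (1 ≤ (axisCoord d L (2 * P + 1) l.1).val ∧ (axisCoord d L (2 * P + 1) l.1).val ≤ P + 1) →
          (1 ≤ (axisCoord d L (2 * P + 1) (l.1 + tiltedUnit d i j (2 * P + 1) (2 * P + 1) L l.2)).val ∧
            (axisCoord d L (2 * P + 1) (l.1 + tiltedUnit d i j (2 * P + 1) (2 * P + 1) L l.2)).val ≤ P + 1) →
          U l = V l) → F U = F V := by
    intro U V hUV
    refine hFdep U V ?_ ?_
    · simpa using hlink 0 (map_zero _) U V hUV
    · exact hlink _ (axisCoord_tiltedTwist d L _ hij) U V hUV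
  exact lt_irrefl _ (lt_of_le_of_lt (hRP F hFm ⟨1, hFb⟩ hFo) hneg)

end Main

/-! ## The negatives for `SU(N)` and `U(N)` -/

section Groups

variable {d : ℕ} {i j : Fin d} {L P N : ℕ} [NeZero L] [NeZero P]

/-- **In-plane link RP fails on the odd square tilted box for `SU(N)` lattice Yang–Mills** (`N ≥ 2`,
fundamental representation, every real `β`; closed half `{1 ≤ x_i ≤ P + 1}`). [folklore] -/
theorem not_tiltedBox_midAxisRP_odd_suN (hij : i ≠ j) (hN : 2 ≤ N) (β : ℝ) :
    ¬ ∀ F : Config (TiltedSite d i j (2 * P + 1) (2 * P + 1) L) d (Matrix.specialUnitaryGroup (Fin N) ℂ) → ℂ,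
        Measurable F → (∃ C : ℝ, ∀ U, ‖F U‖ ≤ C) →
        (∀ U V : Config (TiltedSite d i j (2 * P + 1) (2 * P + 1) L) d (Matrix.specialUnitaryGroup (Fin N) ℂ),
          (∀ l : Link (TiltedSite d i j (2 * P + 1) (2 * P + 1) L) d,
            (1 ≤ (axisCoord d L (2 * P + 1) l.1).val ∧ (axisCoord d L (2 * P + 1) l.1).val ≤ P + 1) →
            (1 ≤ (axisCoord d L (2 * P + 1) (l.1 + tiltedUnit d i j (2 * P + 1) (2 * P + 1) L l.2)).val ∧
              (axisCoord d L (2 * P + 1) (l.1 + tiltedUnit d i j (2 * P + 1) (2 * P + 1) L l.2)).val ≤ P + 1) →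
            U l = V l) → F U = F V) →
        0 ≤ ∫ U, conj (F (configMidReflect (tiltedUnit d i j (2 * P + 1) (2 * P + 1) L) i
          (tiltedAxisFlip d L (2 * P + 1) hij) U)) * F U
          ∂(gibbs (fundamentalRep (Fin N)) (tiltedUnit d i j (2 * P + 1) (2 * P + 1) L) β) := by
  haveI : SecondCountableTopology (Matrix (Fin N) (Fin N) ℂ) :=
    inferInstanceAs (SecondCountableTopology (Fin N → Fin N → ℂ))
  haveI : SecondCountableTopology (Matrix.specialUnitaryGroup (Fin N) ℂ) :=
    Topology.IsEmbedding.subtypeVal.secondCountableTopology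
  haveI : Nontrivial (Matrix.specialUnitaryGroup (Fin N) ℂ) := by
    obtain ⟨g, hg⟩ := exists_fundamentalRep_ne_one hN
    exact nontrivial_of_ne g 1 fun h => hg (by rw [h, map_one])
  exact not_tiltedBox_midAxisRP_odd (fundamentalRep (Fin N)) hij (continuous_fundamentalRep (Fin N)) β

/-- **In-plane link RP fails on the odd square tilted box for `U(N)` lattice gauge theory**
(`N ≥ 1`, every real `β`). [folklore] -/
theorem not_tiltedBox_midAxisRP_odd_uN (hij : i ≠ j) (hN : 1 ≤ N) (β : ℝ) :
    ¬ ∀ F : Config (TiltedSite d i j (2 * P + 1) (2 * P + 1) L) d (Matrix.unitaryGroup (Fin N) ℂ) → ℂ,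
        Measurable F → (∃ C : ℝ, ∀ U, ‖F U‖ ≤ C) →
        (∀ U V : Config (TiltedSite d i j (2 * P + 1) (2 * P + 1) L) d (Matrix.unitaryGroup (Fin N) ℂ),
          (∀ l : Link (TiltedSite d i j (2 * P + 1) (2 * P + 1) L) d,
            (1 ≤ (axisCoord d L (2 * P + 1) l.1).val ∧ (axisCoord d L (2 * P + 1) l.1).val ≤ P + 1) →
            (1 ≤ (axisCoord d L (2 * P + 1) (l.1 + tiltedUnit d i j (2 * P + 1) (2 * P + 1) L l.2)).val ∧
              (axisCoord d L (2 * P + 1) (l.1 + tiltedUnit d i j (2 * P + 1) (2 * P + 1) L l.2)).val ≤ P + 1) →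
            U l = V l) → F U = F V) →
        0 ≤ ∫ U, conj (F (configMidReflect (tiltedUnit d i j (2 * P + 1) (2 * P + 1) L) i
          (tiltedAxisFlip d L (2 * P + 1) hij) U)) * F U
          ∂(gibbs (unitaryFundamentalRep (Fin N) ℂ) (tiltedUnit d i j (2 * P + 1) (2 * P + 1) L) β) := by
  haveI : SecondCountableTopology (Matrix (Fin N) (Fin N) ℂ) :=
    inferInstanceAs (SecondCountableTopology (Fin N → Fin N → ℂ))
  haveI : SecondCountableTopology (Matrix.unitaryGroup (Fin N) ℂ) :=
    Topology.IsEmbedding.subtypeVal.secondCountableTopology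
  haveI : Nontrivial (Matrix.unitaryGroup (Fin N) ℂ) := by
    obtain ⟨g, hg⟩ := exists_unitaryFundamentalRep_ne_one hN
    exact nontrivial_of_ne g 1 fun h => hg (by rw [h, map_one])
  exact not_tiltedBox_midAxisRP_odd (unitaryFundamentalRep (Fin N) ℂ) hij
    (continuous_unitaryFundamentalRep (n := Fin N) (𝕜 := ℂ)) β

end Groups

end TiltedRP

end Summit.QuantumFields.GaugeBoot

end
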